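import Summits.BirchSwinnertonDyer.Rank1Residual.X11b.Three.GoodReductionSubgroupNodeH1NonsplitMult
import Summits.BirchSwinnertonDyer.Rank1Residual.X11b.Three.GoodReductionSubgroupValuation
import Summits.BirchSwinnertonDyer.Rank1Residual.X11b.Three.MultiplicativeNodePresentationPadic
import HarnessLib

/-!
# X11b at `p = 3` (team N8/O2), JET3-KUMMER (α) at EVERY MULTIPLICATIVE place, in one call:
# split and non-split glued (`HasMultiplicativeReduction` alone), the formal-group half supplied by
# x11b3-p4's intrinsic `h1ker_of_adicComplete` (no `w`), and the `E/ℚ` form in the class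
# predicate `W.HasMultiplicativeReductionAtPrime p`

HONEST FRAMING (cell `b2b-bsdres`, run/shared/lean/b2b/bsd-rank1-residual/, verbatim in every
file): the goal of the cell is to DELETE the COMBINATION-SHAPED residual classes of the
Birch–Swinnerton-Dyer formula for ALL analytic-rank `≤ 1` elliptic curves over `ℚ` — "full BSD
formula for every rank `≤ 1` curve in class `C`" assembled STRICTLY from published theorems — so
that the rank-`≤ 1` remainder becomes exactly the CONSTRUCTION-SHAPED classes, which are TYPED
(missing-input `Prop`s), NOT attempted. This is not "finishing BSD". Team N8/O2 = `x11b3`, seat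
`b2b-bsdres-x11b3-p3` (GEN 3), LEAD DEAL #7 (R7-7), sub-target S15 (ii), part 5 = the GLUE asked
for by the S15 interface owner (x11b3-p4, `S15-INTERFACE.md` v1 §2–§3: "feed
`h1ker_of_adicComplete` into `hα_of_h1ker_of_nonsplit_node`"). THEOREMS ONLY: no definition, no
named fact, no `sorry`; nothing is booked; the flag `JET@p|N` is NOT discharged.

## What

S15 proved p1's hypothesis (α) of `JetchevKummerAtP` at a multiplicative place in two halves and
two signs: the formal-group half `h1ker` (x11b3-p4, parts 6–8 and the intrinsic part 11
`h1ker_of_adicComplete`), the `Ẽ_ns` half at a SPLIT node (p4 part 5 + x11b3-p8's presentation)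
and at a NON-SPLIT node (this seat, parts 1–4). The consumer (x11b3-p1's assembly (iv)) should
not have to case on the sign. This file glues (`by_cases` on `HasSplitMultiplicativeReduction`):

* §1 (abstract layer `L/F`, adically complete `R`, NO stub, NO valuation binder):
  `hα_of_not_hasSplitMultiplicativeReduction_of_adicComplete` (`w`-free form of part 4 §3),
  **`hα_of_hasMultiplicativeReduction_of_adicComplete`** ((α) HOLDS at every multiplicative place
  over a complete unramified layer; hypothesis `[(X.baseChange L).HasMultiplicativeReduction R]`
  ONLY — p8's §4 in the split case, part 4 in the non-split case, both fed with
  `h1ker_of_adicComplete`),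
  `exists_baseChange_eq_add_pow_smul_of_hasMultiplicativeReduction_of_adicComplete` (Jetchev's
  Prop. 4.1 at `v` modulo (a), (b), the cocycle ONLY). Residual binders =
  `S15-INTERFACE.md` §4 R1–R8 (`hR`, `[IsAdicComplete 𝔪 R]`, `[Finite k]` + `hcard`,
  `φ`/`hφ`/`hn`/`hfrob`, `hϖ`/`hπ`, `[IsGalois F L]`, minimality/ellipticity instances, `W₀`/`hX`);
  R9 for (ii)(A) is EMPTY (the residue-level `k' = k̄` is chosen inside part 4).
* §2 (`E/ℚ` globally minimal, class predicate `h : W.HasMultiplicativeReductionAtPrime p`, layer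
  `L ⊇ ℚ_p` with `ℤ_p → R` local — p8's `MultiplicativeNodePresentationPadic` currency):
  `exists_baseChange_eq_add_pow_smul_padic_of_h1ker_of_hasMultiplicativeReductionAtPrime` (p8's
  end form with SPLIT weakened to MULTIPLICATIVE, `R` henselian, stub `h1ker` by name),
  **`hα_padic_of_hasMultiplicativeReductionAtPrime_of_adicComplete`**,
  **`exists_baseChange_eq_add_pow_smul_padic_of_hasMultiplicativeReductionAtPrime_of_adicComplete`**
  (NO stub: `T = ι(t₀ + p^m t₁)`, `t₀ ∈ E₀(ℚ_p)`, for `E/ℚ` multiplicative at `p` — either sign,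
  any parity of `[k : 𝔽_p]`). For X11b at `p = 3` (`3 ∥ N`): `h` is the class's multiplicative leg.

Nothing here is new mathematics: every proof is a one-line composition of landed theorems
(p4: p252933, p253944, p255785; p8: p255042, p255463; p3: p256283).

References (locators only; no new fact): [cite: MilneADT2006, Ch. I Prop. 3.8]
[cite: SilvermanAEC2009, VII.2 Prop. 2.1–2.2 (PDF p. 167), VII.§5 (PDF p. 174), Exercise 3.5(a)
(PDF p. 97), Prop. VII.5.4 (b) (PDF p. 175)] [cite: SerreLocalFields1979, X §1 (Hilbert 90)]
[cite: Jetchev2008, Prop. 4.1 (p. 819)].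

## Design

No definitions. In §1 `F L : Type u`; in §2 `L : Type` (the universe of `ℚ_[p]`). The two
`IsMinimal` instance binders of the §2 statements (needed to STATE `E₀` before `h` is introduced)
are discharged by p8's `isMinimal_baseChange_padic_self W p` and
`(hasMultiplicativeReduction_baseChange_padic W p L R h).toIsMinimal`. Axioms: standard three.
-/

noncomputable section

open scoped Classical

namespace Summit.BirchSwinnertonDyer.Rank1Residual.X11b.Three.JetchevKummer

open WeierstrassCurve Literature.NumberTheory.EllipticCurves

universe u

/-! ### §1 Adically complete layer: (α) with NO stub and NO valuation binder -/

section AdicComplete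

variable {F : Type u} [Field F] (X : WeierstrassCurve F) (L : Type u) [Field L] [Algebra F L]
  (R : Type*) [CommRing R] [IsDomain R] [IsDiscreteValuationRing R] [Algebra R L]
  [IsFractionRing R L] [IsAdicComplete (IsLocalRing.maximalIdeal R) R]
  [Finite (IsLocalRing.ResidueField R)] [(X.baseChange L).IsElliptic]
  [(X.baseChange L).HasMultiplicativeReduction R]
  (W₀ : WeierstrassCurve R) (hX : X.baseChange L = W₀.baseChange L)

include hX in
/-- **(α) of `JetchevKummerAtP` HOLDS — no stub, no valuation binder — at a NON-SPLIT
multiplicative place** over an adically complete unramified layer: part 4's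
`hα_of_h1ker_of_not_hasSplitMultiplicativeReduction` fed with x11b3-p4's intrinsic
`h1ker_of_adicComplete` (the `w`-free twin of part 4's
`hα_of_not_hasSplitMultiplicativeReduction_of_complete` and of p4's `hα_of_node_of_adicComplete`).
Binders: `hns`, `hR`, `φ`/`hφ`/`hn`, `hcard`, `hfrob`, a uniformiser `ϖ` of `R` coming from `π ∈ F`
(`L/F` unramified).
[cite: MilneADT2006, Ch. I Prop. 3.8] [cite: SilvermanAEC2009, VII.2 Prop. 2.1–2.2, Ex. 3.5(a)] -/
theorem hα_of_not_hasSplitMultiplicativeReduction_of_adicComplete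
    (hns : ¬ (X.baseChange L).HasSplitMultiplicativeReduction R)
    (hR : ∀ (τ : L ≃ₐ[F] L) (x : L), x ∈ Set.range (algebraMap R L) →
      τ x ∈ Set.range (algebraMap R L))
    (φ : L ≃ₐ[F] L) (hφ : ∀ σ : L ≃ₐ[F] L, σ ∈ Subgroup.zpowers φ) {q n : ℕ} (hn : φ ^ n = 1)
    (hcard : Nat.card (IsLocalRing.ResidueField R) = q ^ n)
    (hfrob : ∀ a : R, ∃ a' : R, algebraMap R L a' = φ (algebraMap R L a) ∧
      IsLocalRing.residue R a' = IsLocalRing.residue R a ^ q)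
    {ϖ : R} (hϖ : Irreducible ϖ) {π : F} (hπ : algebraMap F L π = algebraMap R L ϖ) :
    ∀ Q : (X.baseChange L).toAffine.Point,
      (∀ σ : L ≃ₐ[F] L, σ • Q - Q ∈ (X.baseChange L).goodReductionSubgroup R) →
        ∃ Q' : (X.baseChange L).toAffine.Point, (∀ σ : L ≃ₐ[F] L, σ • Q' = Q') ∧
          Q - Q' ∈ (X.baseChange L).goodReductionSubgroup R :=
  hα_of_h1ker_of_not_hasSplitMultiplicativeReduction X L R W₀ hX hns hR φ hφ hn hcard hfrob
    (h1ker_of_adicComplete X L R W₀ hX hR φ hn hcard hfrob hϖ hπ)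

include hX in
/-- **(α) of `JetchevKummerAtP` HOLDS — no stub — at EVERY MULTIPLICATIVE place** (split or
non-split, any parity of `[k : k_v]`) over an adically complete unramified layer: `R` the valuation
ring of `L` (adically complete, finite residue field of `qⁿ` elements), `X ⊗ L` elliptic with
multiplicative reduction over `R`, `Gal(L/F) = ⟨φ⟩`, `φⁿ = 1`, `φ` lifting `x ↦ x^q`, every `τ`
preserving `R`, a uniformiser of `R` from `F`. Then every `Q ∈ E(L)` with all `σ Q − Q ∈ E₀(L)` is
congruent modulo `E₀(L)` to a `Gal(L/F)`-fixed point. Proof: p8's §4 / part 4, fed with p4's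
`h1ker_of_adicComplete`.
Milne, *ADT* I.3.8 (`H¹(k_w/k_v, 𝒜°) = 0` at a finite unramified level, multiplicative fibre).
[cite: MilneADT2006, Ch. I Prop. 3.8] [cite: SilvermanAEC2009, VII.2 Prop. 2.1–2.2, VII.§5,
Exercise 3.5(a)] [cite: SerreLocalFields1979, X §1 (Hilbert 90)] -/
theorem hα_of_hasMultiplicativeReduction_of_adicComplete
    (hR : ∀ (τ : L ≃ₐ[F] L) (x : L), x ∈ Set.range (algebraMap R L) →
      τ x ∈ Set.range (algebraMap R L))
    (φ : L ≃ₐ[F] L) (hφ : ∀ σ : L ≃ₐ[F] L, σ ∈ Subgroup.zpowers φ) {q n : ℕ} (hn : φ ^ n = 1)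
    (hcard : Nat.card (IsLocalRing.ResidueField R) = q ^ n)
    (hfrob : ∀ a : R, ∃ a' : R, algebraMap R L a' = φ (algebraMap R L a) ∧
      IsLocalRing.residue R a' = IsLocalRing.residue R a ^ q)
    {ϖ : R} (hϖ : Irreducible ϖ) {π : F} (hπ : algebraMap F L π = algebraMap R L ϖ) :
    ∀ Q : (X.baseChange L).toAffine.Point,
      (∀ σ : L ≃ₐ[F] L, σ • Q - Q ∈ (X.baseChange L).goodReductionSubgroup R) →
        ∃ Q' : (X.baseChange L).toAffine.Point, (∀ σ : L ≃ₐ[F] L, σ • Q' = Q') ∧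
          Q - Q' ∈ (X.baseChange L).goodReductionSubgroup R := by
  by_cases hs : (X.baseChange L).HasSplitMultiplicativeReduction R
  · exact hα_of_h1ker_of_hasSplitMultiplicativeReduction X L R W₀ hX hR φ hφ hn hcard hfrob
      (h1ker_of_adicComplete X L R W₀ hX hR φ hn hcard hfrob hϖ hπ)
  · exact hα_of_not_hasSplitMultiplicativeReduction_of_adicComplete X L R W₀ hX hs hR φ hφ hn hcard
      hfrob hϖ hπ

include hX in
/-- **Jetchev's Prop. 4.1 at EVERY MULTIPLICATIVE place `v`, modulo p1's inputs (a), (b) and the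
cocycle ONLY**: `T = ι(t₀ + p^m t₁)` with `t₀ ∈ E₀(K_v)`, i.e. `T ∈ E₀(K_v) + p^m E(K_v)`; (α) and
`hstab` of `JetchevKummerAtP` are theorems here (p8 §4 / part 4 + p4's
`h1ker_of_adicComplete`); `JET@p|N` is NOT discharged ((a), (b), (c) + Jetchev §§5–7 remain).
[cite: Jetchev2008, Prop. 4.1 (p. 819)] [cite: GrossLMS1991, Prop. 6.2 (1), pp. 244–245]
[cite: MilneADT2006, Ch. I Prop. 3.8] -/
theorem exists_baseChange_eq_add_pow_smul_of_hasMultiplicativeReduction_of_adicComplete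
    [IsGalois F L]
    (R₀ : Type*) [CommRing R₀] [IsDomain R₀] [IsDiscreteValuationRing R₀] [Algebra R₀ F]
    [IsFractionRing R₀ F] [Algebra R₀ R] [Algebra R₀ L] [IsScalarTower R₀ R L]
    [IsScalarTower R₀ F L] [IsLocalHom (algebraMap R₀ R)] [(X.baseChange F).IsMinimal R₀]
    (hR : ∀ (τ : L ≃ₐ[F] L) (x : L), x ∈ Set.range (algebraMap R L) →
      τ x ∈ Set.range (algebraMap R L))
    (φ : L ≃ₐ[F] L) (hφ : ∀ σ : L ≃ₐ[F] L, σ ∈ Subgroup.zpowers φ) {q n : ℕ} (hn : φ ^ n = 1)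
    (hcard : Nat.card (IsLocalRing.ResidueField R) = q ^ n)
    (hfrob : ∀ a : R, ∃ a' : R, algebraMap R L a' = φ (algebraMap R L a) ∧
      IsLocalRing.residue R a' = IsLocalRing.residue R a ^ q)
    {ϖ : R} (hϖ : Irreducible ϖ) {π : F} (hπ : algebraMap F L π = algebraMap R L ϖ)
    {p m n' : ℕ} (hcop : Nat.Coprime n' (p ^ m)) {U P T : (X.baseChange L).toAffine.Point}
    {Rσ : (L ≃ₐ[F] L) → (X.baseChange L).toAffine.Point}
    (hT : ∀ σ : L ≃ₐ[F] L, σ • T = T)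
    (hP : (n' : ℤ) • P ∈ (X.baseChange L).goodReductionSubgroup R)
    (hRσ : ∀ σ : L ≃ₐ[F] L, (n' : ℤ) • Rσ σ ∈ (X.baseChange L).goodReductionSubgroup R)
    (hU : ∀ σ : L ≃ₐ[F] L, σ • U - U = Rσ σ) (hpU : ((p ^ m : ℕ) : ℤ) • U = P - T) :
    ∃ t₀ t₁ : (X.baseChange F).toAffine.Point,
      t₀ ∈ (X.baseChange F).goodReductionSubgroup R₀ ∧
      T = Affine.Point.baseChange (W' := X.toAffine) F L (t₀ + ((p ^ m : ℕ) : ℤ) • t₁) := by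
  by_cases hs : (X.baseChange L).HasSplitMultiplicativeReduction R
  · exact exists_baseChange_eq_add_pow_smul_of_h1ker_of_hasSplitMultiplicativeReduction X L R W₀ hX
      R₀ hR φ hφ hn hcard hfrob (h1ker_of_adicComplete X L R W₀ hX hR φ hn hcard hfrob hϖ hπ) hcop
      hT hP hRσ hU hpU
  · exact exists_baseChange_eq_add_pow_smul_of_h1ker_of_not_hasSplitMultiplicativeReduction X L R
      W₀ hX R₀ hs hR φ hφ hn hcard hfrob (h1ker_of_adicComplete X L R W₀ hX hR φ hn hcard hfrob hϖ
      hπ) hcop hT hP hRσ hU hpU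

end AdicComplete

/-! ### §2 `E/ℚ` multiplicative at `p`, over a layer `L ⊇ ℚ_p` (x11b3-p8's padic currency) -/

section Padic

variable (W : WeierstrassCurve ℚ) [W.IsElliptic] [W.IsGloballyMinimal] (p : ℕ) [Fact p.Prime]
  (L : Type) [Field L] [Algebra ℚ_[p] L]
  (R : Type*) [CommRing R] [IsDomain R] [IsDiscreteValuationRing R] [Algebra R L]
  [IsFractionRing R L] [Algebra ℤ_[p] R] [Algebra ℤ_[p] L] [IsScalarTower ℤ_[p] R L]
  [IsScalarTower ℤ_[p] ℚ_[p] L] [IsLocalHom (algebraMap ℤ_[p] R)]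

/-- **Jetchev's Prop. 4.1 at `v ∣ p`, end form, for `E/ℚ` with MULTIPLICATIVE reduction at `p`
(either sign)**, over a Galois layer `L ⊇ ℚ_p` with henselian valuation ring `R` (`ℤ_p → R`
local, finite residue field of `qⁿ` elements, `Aut(L/ℚ_p) = ⟨φ⟩`, `φⁿ = 1`, `φ` lifting
`x ↦ x^q`, every `τ` preserving `R`): given p1's inputs (a) `hT`, (b) `hP`/`hRσ`, the cocycle
`hU`/`hpU` and the ONE stub `h1ker`, `T = ι(t₀ + p^m t₁)` with `t₀ ∈ E₀(ℚ_p)` — x11b3-p8's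
`exists_baseChange_eq_add_pow_smul_padic_of_h1ker` with SPLIT weakened to MULTIPLICATIVE.
[cite: Jetchev2008, Prop. 4.1 (p. 819)] [cite: MilneADT2006, Ch. I Prop. 3.8] -/
theorem exists_baseChange_eq_add_pow_smul_padic_of_h1ker_of_hasMultiplicativeReductionAtPrime
    [IsGalois ℚ_[p] L] [HenselianRing R (IsLocalRing.maximalIdeal R)]
    [Finite (IsLocalRing.ResidueField R)] [((W.baseChange ℚ_[p]).baseChange L).IsMinimal R]
    [((W.baseChange ℚ_[p]).baseChange ℚ_[p]).IsMinimal ℤ_[p]]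
    (h : W.HasMultiplicativeReductionAtPrime p) (W₀ : WeierstrassCurve R)
    (hX : (W.baseChange ℚ_[p]).baseChange L = W₀.baseChange L)
    (hR : ∀ (τ : L ≃ₐ[ℚ_[p]] L) (x : L), x ∈ Set.range (algebraMap R L) →
      τ x ∈ Set.range (algebraMap R L))
    (φ : L ≃ₐ[ℚ_[p]] L) (hφ : ∀ σ : L ≃ₐ[ℚ_[p]] L, σ ∈ Subgroup.zpowers φ) {q n : ℕ}
    (hn : φ ^ n = 1) (hcard : Nat.card (IsLocalRing.ResidueField R) = q ^ n)
    (hfrob : ∀ a : R, ∃ a' : R, algebraMap R L a' = φ (algebraMap R L a) ∧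
      IsLocalRing.residue R a' = IsLocalRing.residue R a ^ q)
    (h1ker : ∀ m ∈ {Q : ((W.baseChange ℚ_[p]).baseChange L).toAffine.Point | ∀ (x y : L)
        (h : ((W.baseChange ℚ_[p]).baseChange L).toAffine.Nonsingular x y), Q = .some x y h →
          x ∉ Set.range (algebraMap R L)},
      ∑ j ∈ Finset.range n, (φ ^ j) • m = 0 →
        ∃ P ∈ {Q : ((W.baseChange ℚ_[p]).baseChange L).toAffine.Point | ∀ (x y : L)
          (h : ((W.baseChange ℚ_[p]).baseChange L).toAffine.Nonsingular x y), Q = .some x y h →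
            x ∉ Set.range (algebraMap R L)}, φ • P - P = m)
    {m n' : ℕ} (hcop : Nat.Coprime n' (p ^ m))
    {U P T : ((W.baseChange ℚ_[p]).baseChange L).toAffine.Point}
    {Rσ : (L ≃ₐ[ℚ_[p]] L) → ((W.baseChange ℚ_[p]).baseChange L).toAffine.Point}
    (hT : ∀ σ : L ≃ₐ[ℚ_[p]] L, σ • T = T)
    (hP : (n' : ℤ) • P ∈ ((W.baseChange ℚ_[p]).baseChange L).goodReductionSubgroup R)
    (hRσ : ∀ σ : L ≃ₐ[ℚ_[p]] L,
      (n' : ℤ) • Rσ σ ∈ ((W.baseChange ℚ_[p]).baseChange L).goodReductionSubgroup R)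
    (hU : ∀ σ : L ≃ₐ[ℚ_[p]] L, σ • U - U = Rσ σ) (hpU : ((p ^ m : ℕ) : ℤ) • U = P - T) :
    ∃ t₀ t₁ : ((W.baseChange ℚ_[p]).baseChange ℚ_[p]).toAffine.Point,
      t₀ ∈ ((W.baseChange ℚ_[p]).baseChange ℚ_[p]).goodReductionSubgroup ℤ_[p] ∧
      T = Affine.Point.baseChange (W' := (W.baseChange ℚ_[p]).toAffine) ℚ_[p] L
        (t₀ + ((p ^ m : ℕ) : ℤ) • t₁) := by
  haveI := hasMultiplicativeReduction_baseChange_padic W p L R h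
  by_cases hs : ((W.baseChange ℚ_[p]).baseChange L).HasSplitMultiplicativeReduction R
  · exact exists_baseChange_eq_add_pow_smul_of_h1ker_of_hasSplitMultiplicativeReduction
      (W.baseChange ℚ_[p]) L R W₀ hX ℤ_[p] hR φ hφ hn hcard hfrob h1ker hcop hT hP hRσ hU hpU
  · exact exists_baseChange_eq_add_pow_smul_of_h1ker_of_not_hasSplitMultiplicativeReduction
      (W.baseChange ℚ_[p]) L R W₀ hX ℤ_[p] hs hR φ hφ hn hcard hfrob h1ker hcop hT hP hRσ hU hpU

/-- **(α) of `JetchevKummerAtP` HOLDS — no stub — for `E/ℚ` with MULTIPLICATIVE reduction at `p`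
(either sign, any parity of `[k : 𝔽_p]`)**, over a layer `L ⊇ ℚ_p` whose valuation ring `R`
(`ℤ_p → R` local) is adically complete with finite residue field of `qⁿ` elements,
`Aut(L/ℚ_p) = ⟨φ⟩`, `φⁿ = 1`, `φ` lifting `x ↦ x^q`, every `τ` preserving `R`, and a uniformiser
`ϖ` of `R` coming from `π ∈ ℚ_p` (`L/ℚ_p` unramified; `π = p`): every `Q ∈ E(L)` with all
`σ Q − Q ∈ E₀(L)` is congruent modulo `E₀(L)` to an `Aut(L/ℚ_p)`-fixed point (§1 + p8's
`hasMultiplicativeReduction_baseChange_padic`). [cite: MilneADT2006, Ch. I Prop. 3.8]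
[cite: SilvermanAEC2009, VII.2 Prop. 2.1–2.2, VII.§5, Exercise 3.5(a), Prop. VII.5.4 (b)] -/
theorem hα_padic_of_hasMultiplicativeReductionAtPrime_of_adicComplete
    [IsAdicComplete (IsLocalRing.maximalIdeal R) R] [Finite (IsLocalRing.ResidueField R)]
    [((W.baseChange ℚ_[p]).baseChange L).IsMinimal R]
    (h : W.HasMultiplicativeReductionAtPrime p) (W₀ : WeierstrassCurve R)
    (hX : (W.baseChange ℚ_[p]).baseChange L = W₀.baseChange L)
    (hR : ∀ (τ : L ≃ₐ[ℚ_[p]] L) (x : L), x ∈ Set.range (algebraMap R L) →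
      τ x ∈ Set.range (algebraMap R L))
    (φ : L ≃ₐ[ℚ_[p]] L) (hφ : ∀ σ : L ≃ₐ[ℚ_[p]] L, σ ∈ Subgroup.zpowers φ) {q n : ℕ}
    (hn : φ ^ n = 1) (hcard : Nat.card (IsLocalRing.ResidueField R) = q ^ n)
    (hfrob : ∀ a : R, ∃ a' : R, algebraMap R L a' = φ (algebraMap R L a) ∧
      IsLocalRing.residue R a' = IsLocalRing.residue R a ^ q)
    {ϖ : R} (hϖ : Irreducible ϖ) {π : ℚ_[p]} (hπ : algebraMap ℚ_[p] L π = algebraMap R L ϖ) :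
    ∀ Q : ((W.baseChange ℚ_[p]).baseChange L).toAffine.Point,
      (∀ σ : L ≃ₐ[ℚ_[p]] L,
          σ • Q - Q ∈ ((W.baseChange ℚ_[p]).baseChange L).goodReductionSubgroup R) →
        ∃ Q' : ((W.baseChange ℚ_[p]).baseChange L).toAffine.Point,
          (∀ σ : L ≃ₐ[ℚ_[p]] L, σ • Q' = Q') ∧
            Q - Q' ∈ ((W.baseChange ℚ_[p]).baseChange L).goodReductionSubgroup R := by
  haveI := hasMultiplicativeReduction_baseChange_padic W p L R h
  exact hα_of_hasMultiplicativeReduction_of_adicComplete (W.baseChange ℚ_[p]) L R W₀ hX hR φ hφ hn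
    hcard hfrob hϖ hπ

/-- **Jetchev's Prop. 4.1 at `v ∣ p`, end form, NO stub, for `E/ℚ` with MULTIPLICATIVE reduction
at `p` (either sign)** — the single entry point for x11b3-p1's assembly (iv) at a multiplicative
`p` (for X11b at `p = 3`, `3 ∥ N`): over a Galois layer `L ⊇ ℚ_p` whose valuation ring `R`
(`ℤ_p → R` local) is adically complete with finite residue field of `qⁿ` elements,
`Aut(L/ℚ_p) = ⟨φ⟩`, `φⁿ = 1`, `φ` lifting `x ↦ x^q`, every `τ` preserving `R`, a uniformiser of
`R` from `ℚ_p`; given p1's inputs (a) `hT`, (b) `hP`/`hRσ` and the cocycle `hU`/`hpU`: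
`T = ι(t₀ + p^m t₁)` with `t₀ ∈ E₀(ℚ_p)`. Residual binders = `S15-INTERFACE.md` §4 R1–R8 and
nothing else (no `w`, no `hW`/`hα`, no `h1ker`/`h1red`/`hstab`, no sign or parity case). Nothing
is booked; the flag `JET@p|N` is NOT discharged. [cite: Jetchev2008, Prop. 4.1 (p. 819)]
[cite: MilneADT2006, Ch. I Prop. 3.8] [cite: GrossLMS1991, Prop. 6.2 (1), pp. 244–245] -/
theorem exists_baseChange_eq_add_pow_smul_padic_of_hasMultiplicativeReductionAtPrime_of_adicComplete
    [IsGalois ℚ_[p] L] [IsAdicComplete (IsLocalRing.maximalIdeal R) R]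
    [Finite (IsLocalRing.ResidueField R)] [((W.baseChange ℚ_[p]).baseChange L).IsMinimal R]
    [((W.baseChange ℚ_[p]).baseChange ℚ_[p]).IsMinimal ℤ_[p]]
    (h : W.HasMultiplicativeReductionAtPrime p) (W₀ : WeierstrassCurve R)
    (hX : (W.baseChange ℚ_[p]).baseChange L = W₀.baseChange L)
    (hR : ∀ (τ : L ≃ₐ[ℚ_[p]] L) (x : L), x ∈ Set.range (algebraMap R L) →
      τ x ∈ Set.range (algebraMap R L))
    (φ : L ≃ₐ[ℚ_[p]] L) (hφ : ∀ σ : L ≃ₐ[ℚ_[p]] L, σ ∈ Subgroup.zpowers φ) {q n : ℕ}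
    (hn : φ ^ n = 1) (hcard : Nat.card (IsLocalRing.ResidueField R) = q ^ n)
    (hfrob : ∀ a : R, ∃ a' : R, algebraMap R L a' = φ (algebraMap R L a) ∧
      IsLocalRing.residue R a' = IsLocalRing.residue R a ^ q)
    {ϖ : R} (hϖ : Irreducible ϖ) {π : ℚ_[p]} (hπ : algebraMap ℚ_[p] L π = algebraMap R L ϖ)
    {m n' : ℕ} (hcop : Nat.Coprime n' (p ^ m))
    {U P T : ((W.baseChange ℚ_[p]).baseChange L).toAffine.Point}
    {Rσ : (L ≃ₐ[ℚ_[p]] L) → ((W.baseChange ℚ_[p]).baseChange L).toAffine.Point}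
    (hT : ∀ σ : L ≃ₐ[ℚ_[p]] L, σ • T = T)
    (hP : (n' : ℤ) • P ∈ ((W.baseChange ℚ_[p]).baseChange L).goodReductionSubgroup R)
    (hRσ : ∀ σ : L ≃ₐ[ℚ_[p]] L,
      (n' : ℤ) • Rσ σ ∈ ((W.baseChange ℚ_[p]).baseChange L).goodReductionSubgroup R)
    (hU : ∀ σ : L ≃ₐ[ℚ_[p]] L, σ • U - U = Rσ σ) (hpU : ((p ^ m : ℕ) : ℤ) • U = P - T) :
    ∃ t₀ t₁ : ((W.baseChange ℚ_[p]).baseChange ℚ_[p]).toAffine.Point,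
      t₀ ∈ ((W.baseChange ℚ_[p]).baseChange ℚ_[p]).goodReductionSubgroup ℤ_[p] ∧
      T = Affine.Point.baseChange (W' := (W.baseChange ℚ_[p]).toAffine) ℚ_[p] L
        (t₀ + ((p ^ m : ℕ) : ℤ) • t₁) := by
  haveI := hasMultiplicativeReduction_baseChange_padic W p L R h
  exact exists_baseChange_eq_add_pow_smul_of_hasMultiplicativeReduction_of_adicComplete
    (W.baseChange ℚ_[p]) L R W₀ hX ℤ_[p] hR φ hφ hn hcard hfrob hϖ hπ hcop hT hP hRσ hU hpU

end Padic

end Summit.BirchSwinnertonDyer.Rank1Residual.X11b.Three.JetchevKummer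

end
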